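import Mathlib
import HarnessLib
import Summits.Ventures.LatticeQCDFlow.Exactness.LaggedAdaptationJointLaw

/-!
# LatticeQCDFlow / Exactness — LEARNING ON THE JOB, XVI: AN EPOCH OF LENGTH `T` SAMPLED WITH THE FLOW FROZEN AT ITS START HAS AVERAGE ONE-TIME
# BIAS AT MOST `(1 − ε)/(εT)` (`= (W − 1)/T` for weights `≤ W`), WHATEVER THE RETRAINING DID AT THE EPOCH BOUNDARY

HONEST FRAMING: exact (Metropolis-corrected) sampling algorithms for lattice gauge theory;
figures of merit are autocorrelation/cost numbers at stated couplings and volumes; no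
continuum-physics claim.

Venture `LatticeQCDFlow` (cell pub-lqcd), topic `Exactness`, FANOUT row 30 (lean-1 GEN-44, theme LEARNING ON THE JOB).  NEW WORK of the
cell; no definition is introduced, nothing is cited as a fact.  Tree input: `LaggedAdaptationJointLaw` (`frozenStep_config_real_sub_le`: the
`j`-th configuration of the epoch is within `(1 − ε)ʲ` of `π` from ANY joint law of (frozen parameters, configuration) at the epoch start).
The number an estimate actually uses is the AVERAGE over the epoch of the one-time laws; summing the geometric bound gives it.

## Setting
As in `LaggedAdaptationJointLaw`: `π` a probability; `κ : Kernel (H × Ω) Ω` with `π`-exact frozen sections and `ε·π ≤ κ(h, x)`, `0 < ε ≤ 1`; the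
frozen-parameter step `Ĵ` on `H × Ω` (`hJ`); an epoch = `T` consecutive frozen steps from the joint law `ρ` at the epoch boundary — `ρ` arbitrary:
the parameters were just fitted to everything before, including the configuration they now steer.

## Results (no `sorry`)
* `geom_sum_shift_le_of_lt_one` — `Σ_{j<T} r^{j+1} ≤ r/(1 − r)` for `0 ≤ r < 1` (bookkeeping, via the full geometric series).
* **`epochAverage_real_sub_le`** — `|(1/T)·Σ_{j=1}^{T} (ρĴʲ)(H × B) − π(B)| ≤ (1 − ε)/(ε·T)` for every `T ≥ 1`, every `B`, every epoch-boundary law `ρ`: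
  the empirical one-time law of an epoch is `O(1/T)`-close to `π` with the constant `(1 − ε)/ε = W − 1` for flows with weights `≤ W` — the price of
  retraining on the production chain at epoch boundaries is a burn-in's worth of bias per epoch, not a drift.
* `epochAverage_real_sub_le'` — the same with the bound written `(ε⁻¹ − 1)/T`.
NOT here: the variance of the epoch average (autocorrelations), and anything when parameters change inside the epoch (`SelfTunedFlowChoiceBias`).
-/

namespace Summit.Ventures.LatticeQCDFlow.Exactness

open MeasureTheory ProbabilityTheory Finset
open scoped _root_.ENNReal

variable {Ω H : Type*} [MeasurableSpace Ω] [MeasurableSpace H] {π : Measure Ω} [IsProbabilityMeasure π]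

omit [MeasurableSpace Ω] [MeasurableSpace H] [IsProbabilityMeasure π] in
/-- `Σ_{j<T} r^{j+1} ≤ r/(1 − r)` for `0 ≤ r < 1`. [ours, bookkeeping] -/
theorem geom_sum_shift_le_of_lt_one {r : ℝ} (hr0 : 0 ≤ r) (hr1 : r < 1) (T : ℕ) : ∑ j ∈ range T, r ^ (j + 1) ≤ r / (1 - r) := by
  have hs : Summable fun n : ℕ => r ^ n := summable_geometric_of_lt_one hr0 hr1
  calc ∑ j ∈ range T, r ^ (j + 1) = r * ∑ j ∈ range T, r ^ j := by rw [mul_sum]; exact sum_congr rfl fun j _ => by ring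
    _ ≤ r * ∑' n : ℕ, r ^ n := by
        refine mul_le_mul_of_nonneg_left ?_ hr0
        exact hs.sum_le_tsum (range T) fun n _ => pow_nonneg hr0 n
    _ = r / (1 - r) := by rw [tsum_geometric_of_lt_one hr0 hr1, div_eq_mul_inv]

/-- **THE EPOCH AVERAGE IS `(1 − ε)/(εT)`-CLOSE TO `π`**: for the frozen-parameter sampler of `LaggedAdaptationJointLaw` (`π`-exact sections,
`ε·π ≤ κ`, `0 < ε ≤ 1`), every epoch-boundary joint law `ρ`, every `T ≥ 1` and every `B`:
`|(1/T)·Σ_{j=1}^{T} (ρĴʲ)(H × B) − π(B)| ≤ (1 − ε)/(ε·T)`. [ours] -/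
theorem epochAverage_real_sub_le (κ : Kernel (H × Ω) Ω) [IsMarkovKernel κ] (J : Kernel (H × Ω) (H × Ω))
    (hJ : ∀ (h : H) (x : Ω) {C : Set (H × Ω)}, MeasurableSet C → J (h, x) C = κ (h, x) ((fun y => (h, y)) ⁻¹' C))
    (hκ : ∀ (h : H) {B : Set Ω}, MeasurableSet B → ∫⁻ x, κ (h, x) B ∂π = π B) {ε : ℝ≥0∞}
    (hmin : ∀ (h : H) (x : Ω) {B : Set Ω}, MeasurableSet B → ε * π B ≤ κ (h, x) B) (hε0 : 0 < ε) (hε1 : ε ≤ 1)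
    (ρ : Measure (H × Ω)) [IsProbabilityMeasure ρ] {T : ℕ} (hT : 0 < T) (B : Set Ω) :
    |(∑ j ∈ range T, ((fun ν : Measure (H × Ω) => ν.bind J)^[j + 1] ρ).real (Set.univ ×ˢ B)) / T - π.real B| ≤
      (1 - ε.toReal) / (ε.toReal * T) := by
  set r : ℝ := 1 - ε.toReal with hr
  have hεt : ε ≠ ⊤ := ne_top_of_le_ne_top ENNReal.one_ne_top hε1
  have hεpos : 0 < ε.toReal := ENNReal.toReal_pos hε0.ne' hεt
  have hεle : ε.toReal ≤ 1 := by
    have := ENNReal.toReal_mono ENNReal.one_ne_top hε1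
    rwa [ENNReal.toReal_one] at this
  have hr0 : 0 ≤ r := by rw [hr]; linarith
  have hr1 : r < 1 := by rw [hr]; linarith
  have hTpos : (0 : ℝ) < T := by exact_mod_cast hT
  -- per-step bounds, summed
  have hstep : ∀ j ∈ range T, |((fun ν : Measure (H × Ω) => ν.bind J)^[j + 1] ρ).real (Set.univ ×ˢ B) - π.real B| ≤ r ^ (j + 1) :=
    fun j _ => frozenStep_config_real_sub_le κ J hJ hκ hmin hε1 ρ (j + 1) B
  have hsum : |∑ j ∈ range T, (((fun ν : Measure (H × Ω) => ν.bind J)^[j + 1] ρ).real (Set.univ ×ˢ B) - π.real B)| ≤ r / (1 - r) :=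
    (abs_sum_le_sum_abs _ _).trans ((sum_le_sum hstep).trans (geom_sum_shift_le_of_lt_one hr0 hr1 T))
  have hrew : (∑ j ∈ range T, ((fun ν : Measure (H × Ω) => ν.bind J)^[j + 1] ρ).real (Set.univ ×ˢ B)) / T - π.real B =
      (∑ j ∈ range T, (((fun ν : Measure (H × Ω) => ν.bind J)^[j + 1] ρ).real (Set.univ ×ˢ B) - π.real B)) / T := by
    rw [sum_sub_distrib, sum_const, card_range, nsmul_eq_mul, sub_div, mul_div_cancel_left₀ _ hTpos.ne']
  rw [hrew, abs_div, abs_of_pos hTpos, div_le_iff₀ hTpos]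
  calc |∑ j ∈ range T, (((fun ν : Measure (H × Ω) => ν.bind J)^[j + 1] ρ).real (Set.univ ×ˢ B) - π.real B)| ≤ r / (1 - r) := hsum
    _ = (1 - ε.toReal) / (ε.toReal * T) * T := by
        rw [hr, sub_sub_cancel]; field_simp

/-- … with the constant written `ε⁻¹ − 1` (`= W − 1` for flows with normalised weights `≤ W`, `ε = 1/W`). [ours] -/
theorem epochAverage_real_sub_le' (κ : Kernel (H × Ω) Ω) [IsMarkovKernel κ] (J : Kernel (H × Ω) (H × Ω))
    (hJ : ∀ (h : H) (x : Ω) {C : Set (H × Ω)}, MeasurableSet C → J (h, x) C = κ (h, x) ((fun y => (h, y)) ⁻¹' C))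
    (hκ : ∀ (h : H) {B : Set Ω}, MeasurableSet B → ∫⁻ x, κ (h, x) B ∂π = π B) {ε : ℝ≥0∞}
    (hmin : ∀ (h : H) (x : Ω) {B : Set Ω}, MeasurableSet B → ε * π B ≤ κ (h, x) B) (hε0 : 0 < ε) (hε1 : ε ≤ 1)
    (ρ : Measure (H × Ω)) [IsProbabilityMeasure ρ] {T : ℕ} (hT : 0 < T) (B : Set Ω) :
    |(∑ j ∈ range T, ((fun ν : Measure (H × Ω) => ν.bind J)^[j + 1] ρ).real (Set.univ ×ˢ B)) / T - π.real B| ≤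
      (ε.toReal⁻¹ - 1) / T := by
  have hεt : ε ≠ ⊤ := ne_top_of_le_ne_top ENNReal.one_ne_top hε1
  have hεpos : 0 < ε.toReal := ENNReal.toReal_pos hε0.ne' hεt
  have h := epochAverage_real_sub_le κ J hJ hκ hmin hε0 hε1 ρ hT B
  have heq : (1 - ε.toReal) / (ε.toReal * T) = (ε.toReal⁻¹ - 1) / T := by
    have hTpos : (0 : ℝ) < T := by exact_mod_cast hT
    field_simp
  rwa [heq] at h

end Summit.Ventures.LatticeQCDFlow.Exactness
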